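import Summits.BirchSwinnertonDyer.BirchSwinnertonDyer.Theorems.LambdaTransportDoorCharEvalBridge
import Literature.NumberTheory.EllipticCurves.PAdicBSDInterpolationProofs
import Literature.NumberTheory.EllipticCurves.PAdicBSDMemIwasawaRatProofs
import Literature.NumberTheory.EllipticCurves.PAdicLFunctionNeZeroHoldsProofs
import HarnessLib

/-!
# The λ-transport door — THE INTERPOLATION BRIDGE, part B (any good ordinary prime `p`): a cyclotomic factor of the
# integral `p`-adic `L`-function IS a vanishing classical twisted `L`-value —
# **`Φ_{p^{n+1}}(1+T) ∣ g ⟺ ∑_a ξ(a)[a/p^m]⁺_E = 0 ⟺ L(E, χ, 1) = 0`** (`m = n + 1 + e₀`, `ι(g) = c·L_p(E,T)`)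

Cell `bsd-rank2`, seat p2, GEN 67 part B (helper toward `EisensteinDepletionAtTwo.DepletedLambdaLawAtTwoModNSF`,
stmt-BirchSwinnertonDyer-27021; consumed by part C on the Matsuno class `𝒞(15A8)`).  HONEST FRAMING: theorems only (no definition,
no named fact, no instance, no `sorry`); every statement is an EQUIVALENCE between a divisibility in `Λ = ℤ_p⟦T⟧` and the vanishing
of a classical twisted `L`-value at `s = 1`, for an elliptic curve with good ORDINARY reduction at `p`, proved from the TREE's
discharged facts (Mazur–Tate–Teitelbaum interpolation `hasSum_coeff_padicLFunction_unitRoot`, Birch's formula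
`ratTwistedSymbolSum_mul_plusPeriod_holds`, `Ω⁺ > 0`, `τ(χ) ≠ 0`, `L_p ∈ Λ ⊗ ℚ_p`); nothing here bounds a rank and BSD is proved
for no curve.

Let `E = W/ℚ` (globally minimal), `p` good ordinary, `f` the newform of `E`, `α = unitRoot W p`, `L_p(E,T) = padicLFunction f α ∈
ℚ_p⟦T⟧`, and `g ∈ Λ` an INTEGRAL LIFT: `ι(g) = c · L_p(E,T)`, `c ∈ ℚ_p^×` (one always exists, `memIwasawaRat_padicLFunction_holds`).
`e₀ = cyclotomicExponent p` (`= 1` for odd `p`, `= 2` for `p = 2`), `γ = cyclotomicGenerator p = 1 + p^{e₀}`; a primitive even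
Dirichlet character `ξ` of conductor `p^m`, `m > e₀`, of `p`-power order (= a character of `Γ`) has `ξ(γ)` of order EXACTLY
`p^{m−e₀}` (`orderOf_apply_cyclotomicGenerator`).  With `m = n + 1 + e₀`:

* §1 `cyclotomic_comp_dvd_iff_ratTwistedSymbolSum_eq_zero` — **`Φ_{p^{n+1}}(1+T) ∣ g` in `Λ` ⟺ `∑_{a mod p^m} ξ(a)[a/p^m]⁺_f = 0`
  in `ℂ_p`** for ANY such `ξ : (ℤ/p^m)^× → ℂ_p^×` (part A at `ζ = ξ(γ)` + interpolation `L_p(ζ − 1) = α^{−m}·∑ξ(a)[a/p^m]⁺` +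
  `α ≠ 0`).  In particular the vanishing of the twisted symbol sum depends only on the CONDUCTOR, not on `ξ`
  (`ratTwistedSymbolSum_eq_zero_iff_of_conductor_eq`).
* §2 `twistedLValue_eq_zero_iff_cyclotomic_comp_dvd` — **for `χ : (ℤ/p^m)^× → ℂ^×` primitive, even, of `p`-power order and ANY
  entire continuation `L` of `L(f, χ, s) = ∑ χ(n)a_n n^{−s}`: `L(1) = 0 ⟺ Φ_{p^{n+1}}(1+T) ∣ g`** (Birch's formula for `χ̄`:
  `(∑ χ̄(a)[a/p^m]⁺)·Ω⁺ = τ(χ̄)·L(f,χ,1)` with `Ω⁺ > 0`, `τ(χ̄) ≠ 0`; transport `ℂ ← ℚ̄ → ℂ_p` of `χ̄` — the `[a/p^m]⁺` are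
  rational — and §1).  Corollaries: `twistedLValue_eq_zero_iff_of_conductor_eq` (**all primitive even `p`-power-order `χ` of the
  same conductor `p^m` have `L(E,χ,1)` vanishing TOGETHER** — Galois-equivariance of the algebraic parts, here read off `Λ`), and the
  lift-free form `twistedLValue_eq_zero_iff_forall_lift`.

References: [cite: MazurTateTeitelbaum1986Invent, §I.8 (8.6), §I.12–I.14 (14.3)] [cite: Washington1997, §7.2]
[cite: RohrlichInventiones1984, Theorem (p. 409)] [cite: GreenbergLNM1716, §1 (after Conj. 1.13)].
-/

set_option linter.dupNamespace false
set_option autoImplicit false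

noncomputable section

open scoped MatrixGroups ModularForm

open Polynomial CongruenceSubgroup DirichletCharacter Literature.NumberTheory.EllipticCurves
  Literature.NumberTheory.EllipticCurves.ModularForms Literature.NumberTheory.EllipticCurves.IwasawaAlgebra
  Summit.BirchSwinnertonDyer.BirchSwinnertonDyer.Theorems.LambdaTransportDoorCharEvalBridge

namespace Summit.BirchSwinnertonDyer.BirchSwinnertonDyer.Theorems.LambdaTransportDoorTwistedLValueBridge

variable {p : ℕ} [hp : Fact p.Prime] {W : WeierstrassCurve ℚ} [W.IsElliptic] [W.IsGloballyMinimal]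
  {N : ℕ} [NeZero N] {f : CuspForm (Gamma0 N) 2}

/-! ## §1 `Φ_{p^{n+1}}(1+T) ∣ g ⟺` the `ℂ_p`-valued twisted symbol sum of conductor `p^{n+1+e₀}` vanishes -/

/-- For a character `ξ` of `Γ` of conductor `p^{n+1+e₀}` (primitive, even, `p`-power order), `ξ(γ)` is a PRIMITIVE
`p^{n+1}`-th root of unity in `ℂ_p`. [cite: Washington1997, §7.2] [cite: MazurTateTeitelbaum1986Invent, §I.13] -/
theorem isPrimitiveRoot_apply_cyclotomicGenerator (n : ℕ)
    (ξ : DirichletCharacter ℂ_[p] (p ^ (n + 1 + cyclotomicExponent p))) (hξ : ξ.IsPrimitive) (hξe : ξ.Even)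
    (hξo : ∃ j : ℕ, orderOf ξ = p ^ j) :
    IsPrimitiveRoot (ξ (cyclotomicGenerator p : ZMod (p ^ (n + 1 + cyclotomicExponent p)))) (p ^ (n + 1)) := by
  have h1 := orderOf_apply_cyclotomicGenerator (p := p) (m := n + 1 + cyclotomicExponent p) (by omega) ξ hξ hξe hξo
  rw [Nat.add_sub_cancel] at h1
  exact h1 ▸ IsPrimitiveRoot.orderOf _

/-- ★★ **A CYCLOTOMIC FACTOR OF THE INTEGRAL `p`-ADIC `L`-FUNCTION IS A VANISHING TWISTED SYMBOL SUM.** `E = W/ℚ` globally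
minimal, `p` good ordinary, `f` its newform, `g ∈ Λ` with `ι(g) = c·L_p(E,T)`, `c ≠ 0`; `ξ` a primitive even Dirichlet
character of conductor `p^m`, `m = n + 1 + e₀`, of `p`-power order, with values in `ℂ_p`.  Then
`Φ_{p^{n+1}}(1+T) ∣ g` in `Λ` ⟺ `∑_{a mod p^m} ξ(a)[a/p^m]⁺_f = 0` — part A at the primitive `p^{n+1}`-th root `ζ = ξ(γ)`
and the interpolation property `L_p(E, ζ − 1) = α^{−m} ∑_a ξ(a)[a/p^m]⁺_f`, `α ≠ 0`.
[cite: MazurTateTeitelbaum1986Invent, §I.12–I.14 (14.3)] [cite: Washington1997, §7.2] -/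
theorem cyclotomic_comp_dvd_iff_ratTwistedSymbolSum_eq_zero (hord : IsOrdinaryAt W p) (hf : IsNewformOf W f)
    {g : IwasawaAlgebra p} {c : ℚ_[p]} (hc : c ≠ 0)
    (hg : iwasawaToPowerSeries p g = PowerSeries.C c * padicLFunction f (unitRoot W p : ℚ_[p])) (n : ℕ)
    (ξ : DirichletCharacter ℂ_[p] (p ^ (n + 1 + cyclotomicExponent p))) (hξ : ξ.IsPrimitive) (hξe : ξ.Even)
    (hξo : ∃ j : ℕ, orderOf ξ = p ^ j) :
    ((((cyclotomic (p ^ (n + 1)) ℤ).comp (X + 1)).map (Int.castRingHom ℤ_[p]) : ℤ_[p][X]) : IwasawaAlgebra p) ∣ g ↔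
      ratTwistedSymbolSum f ξ = 0 := by
  have hζ := isPrimitiveRoot_apply_cyclotomicGenerator n ξ hξ hξe hξo
  rw [cyclotomic_comp_dvd_iff_hasSum_ratSeries_zero n hc hg hζ]
  have hI := hasSum_coeff_padicLFunction_unitRoot hord hf (m := n + 1 + cyclotomicExponent p) (by omega) ξ hξ hξe hξo
  have hα : (unitRoot W p : ℚ_[p]) ≠ 0 := (unitRoot_coe_spec hord).2.2
  have hαm : algebraMap ℚ_[p] ℂ_[p] ((unitRoot W p : ℚ_[p])⁻¹ ^ (n + 1 + cyclotomicExponent p)) ≠ 0 :=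
    (_root_.map_ne_zero _).mpr (pow_ne_zero _ (inv_ne_zero hα))
  refine ⟨fun h0 ↦ (mul_eq_zero.mp (hI.unique h0)).resolve_left hαm, fun hS ↦ ?_⟩
  rwa [hS, mul_zero] at hI

/-- **The vanishing of `∑_a ξ(a)[a/p^m]⁺_f` depends only on the conductor `p^m` (`m > e₀`), not on the character `ξ` of `Γ`**:
both are `Φ_{p^{m−e₀}}(1+T) ∣ g` for an integral lift `g` of `L_p(E,T)` (which exists, `memIwasawaRat_padicLFunction_holds`).
[cite: MazurTateTeitelbaum1986Invent, §I.12–I.14] -/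
theorem ratTwistedSymbolSum_eq_zero_iff_of_conductor_eq (hord : IsOrdinaryAt W p) (hf : IsNewformOf W f) (n : ℕ)
    (ξ₁ ξ₂ : DirichletCharacter ℂ_[p] (p ^ (n + 1 + cyclotomicExponent p))) (h₁ : ξ₁.IsPrimitive) (h₁e : ξ₁.Even)
    (h₁o : ∃ j : ℕ, orderOf ξ₁ = p ^ j) (h₂ : ξ₂.IsPrimitive) (h₂e : ξ₂.Even) (h₂o : ∃ j : ℕ, orderOf ξ₂ = p ^ j) :
    ratTwistedSymbolSum f ξ₁ = 0 ↔ ratTwistedSymbolSum f ξ₂ = 0 := by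
  obtain ⟨k, g, hg⟩ := memIwasawaRat_padicLFunction_holds (W := W) (p := p) (f := f) hord hf
  have hc : ((p : ℚ_[p]) ^ k) ≠ 0 := pow_ne_zero _ (Nat.cast_ne_zero.mpr hp.out.ne_zero)
  rw [← cyclotomic_comp_dvd_iff_ratTwistedSymbolSum_eq_zero hord hf hc hg.symm n ξ₁ h₁ h₁e h₁o,
    ← cyclotomic_comp_dvd_iff_ratTwistedSymbolSum_eq_zero hord hf hc hg.symm n ξ₂ h₂ h₂e h₂o]

/-! ## §2 `L(E, χ, 1) = 0 ⟺ Φ_{p^{n+1}}(1+T) ∣ g` for complex characters `χ` of `Γ` of conductor `p^{n+1+e₀}` -/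

omit [W.IsElliptic] [W.IsGloballyMinimal] in
/-- **Birch's formula read as an equivalence**: for a rational newform `f`, `χ` primitive even mod `m` over `ℂ` and ANY entire
continuation `L` of `L(f, χ, s)`: `L(1) = 0 ⟺ ∑_{a mod m} χ̄(a)[a/m]⁺_f = 0` (`(∑ χ̄(a)[a/m]⁺)·Ω⁺_f = τ(χ̄)·L(1)` with
`Ω⁺_f > 0` and `τ(χ̄) ≠ 0`). [cite: MazurTateTeitelbaum1986Invent, §I.8 (8.6)] -/
theorem twistedLValue_eq_zero_iff_ratTwistedSymbolSum_inv_eq_zero (hf : IsNewformOf W f) {m : ℕ} [NeZero m]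
    (χ : DirichletCharacter ℂ m) (hχ : χ.IsPrimitive) (hχe : χ.Even) {L : ℂ → ℂ} (hLd : Differentiable ℂ L)
    (hL : ∀ s : ℂ, 2 < s.re → L s = twistedLSeries f χ s) :
    L 1 = 0 ↔ ratTwistedSymbolSum f χ⁻¹ = 0 := by
  have hQ : coeffField f = ⊥ := hf.coeffField_eq_bot
  have hχ' : χ⁻¹.IsPrimitive := by
    rw [DirichletCharacter.isPrimitive_def, DirichletCharacter.conductor_inv]; exact hχ
  have hχ'e : χ⁻¹.Even := by
    change χ⁻¹ (-1) = 1
    rw [MulChar.inv_apply_eq_inv']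
    change (χ (-1))⁻¹ = 1
    rw [hχe, inv_one]
  have hB := ratTwistedSymbolSum_mul_plusPeriod_holds (f := f) hf.1 hQ hχ' hχ'e hLd
    (fun s hs ↦ by rw [inv_inv]; exact hL s hs)
  have hΩ : (plusPeriod f : ℂ) ≠ 0 := by exact_mod_cast (IsNewform0.plusPeriod_pos_holds hf.1 hQ).ne'
  have hτ : gaussSum χ⁻¹ (ZMod.stdAddChar (N := m)) ≠ 0 := gaussSum_stdAddChar_ne_zero hχ'
  constructor
  · intro h0
    rw [h0, mul_zero, mul_eq_zero] at hB
    exact hB.resolve_right hΩ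
  · intro hS
    rw [hS, zero_mul, eq_comm, mul_eq_zero] at hB
    exact hB.resolve_left hτ

/-- ★★★ **A VANISHING CLASSICAL TWISTED `L`-VALUE IS A CYCLOTOMIC FACTOR OF THE INTEGRAL `p`-ADIC `L`-FUNCTION.** `E = W/ℚ`
globally minimal, `p` good ordinary, `f` its newform, `g ∈ Λ` with `ι(g) = c·L_p(E,T)`, `c ≠ 0`; `χ : (ℤ/p^m)^× → ℂ^×`
primitive, even, of `p`-power order, `m = n + 1 + e₀`; `L` ANY entire continuation of `L(f, χ, s) = ∑ χ(k)a_k k^{−s}`.  Then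
**`L(1) = 0 ⟺ Φ_{p^{n+1}}(1+T) ∣ g` in `Λ`.**  Proof: Birch (`L(1) = 0 ⟺ ∑χ̄(a)[a/p^m]⁺ = 0` over `ℂ`), transport of `χ̄`
through `ℚ̄` into `ℂ_p` (`exists_ringHomComp_eq`, `ratTwistedSymbolSum_ringHomComp`; primitivity, parity and order are
transport-invariant), and §1. [cite: MazurTateTeitelbaum1986Invent, §I.8 (8.6), §I.14 (14.3)] [cite: Washington1997, §7.2] -/
theorem twistedLValue_eq_zero_iff_cyclotomic_comp_dvd (hord : IsOrdinaryAt W p) (hf : IsNewformOf W f)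
    {g : IwasawaAlgebra p} {c : ℚ_[p]} (hc : c ≠ 0)
    (hg : iwasawaToPowerSeries p g = PowerSeries.C c * padicLFunction f (unitRoot W p : ℚ_[p])) (n : ℕ)
    (χ : DirichletCharacter ℂ (p ^ (n + 1 + cyclotomicExponent p))) (hχ : χ.IsPrimitive) (hχe : χ.Even)
    (hχo : ∃ j : ℕ, orderOf χ = p ^ j) {L : ℂ → ℂ} (hLd : Differentiable ℂ L)
    (hL : ∀ s : ℂ, 2 < s.re → L s = twistedLSeries f χ s) :
    L 1 = 0 ↔
      ((((cyclotomic (p ^ (n + 1)) ℤ).comp (X + 1)).map (Int.castRingHom ℤ_[p]) : ℤ_[p][X]) : IwasawaAlgebra p) ∣ g := by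
  classical
  haveI : NeZero (p ^ (n + 1 + cyclotomicExponent p)) := ⟨pow_ne_zero _ hp.out.ne_zero⟩
  rw [twistedLValue_eq_zero_iff_ratTwistedSymbolSum_inv_eq_zero hf χ hχ hχe hLd hL]
  -- properties of `χ⁻¹`
  have hχ' : χ⁻¹.IsPrimitive := by
    rw [DirichletCharacter.isPrimitive_def, DirichletCharacter.conductor_inv]; exact hχ
  have hχ'e : χ⁻¹.Even := by
    change χ⁻¹ (-1) = 1
    rw [MulChar.inv_apply_eq_inv']
    change (χ (-1))⁻¹ = 1
    rw [hχe, inv_one]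
  have hχ'o : ∃ j : ℕ, orderOf χ⁻¹ = p ^ j := by rw [orderOf_inv]; exact hχo
  -- transport `ℂ ← ℚ̄ → ℂ_p`
  let K := AlgebraicClosure ℚ
  let σ : K →+* ℂ := (@IsAlgClosed.lift ℂ _ _ ℚ _ _ K _ _ (AlgebraicClosure.instAlgebra ℚ) _ _ _
    (AlgebraicClosure.isAlgebraic ℚ)).toRingHom
  let τ : K →+* ℂ_[p] := (@IsAlgClosed.lift ℂ_[p] _ _ ℚ _ _ K _ _
    (AlgebraicClosure.instAlgebra ℚ) _ _ _ (AlgebraicClosure.isAlgebraic ℚ)).toRingHom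
  obtain ⟨ψ, hψ⟩ := exists_ringHomComp_eq σ χ⁻¹
  have hψprim : ψ.IsPrimitive := by
    have h := hχ'; rw [← hψ] at h; exact (isPrimitive_ringHomComp_iff σ ψ).mp h
  have hψe : ψ.Even := by
    have h := hχ'e; rw [← hψ] at h; exact (even_ringHomComp_iff σ ψ).mp h
  have hψo : ∃ j : ℕ, orderOf ψ = p ^ j := by
    have h := hχ'o; rw [← hψ, orderOf_ringHomComp] at h; exact h
  set ξ : DirichletCharacter ℂ_[p] (p ^ (n + 1 + cyclotomicExponent p)) := ψ.ringHomComp τ with hξdef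
  have hξ : ξ.IsPrimitive := (isPrimitive_ringHomComp_iff τ ψ).mpr hψprim
  have hξe : ξ.Even := (even_ringHomComp_iff τ ψ).mpr hψe
  have hξo : ∃ j : ℕ, orderOf ξ = p ^ j := by rw [hξdef, orderOf_ringHomComp]; exact hψo
  have hS : ratTwistedSymbolSum f χ⁻¹ = 0 ↔ ratTwistedSymbolSum f ξ = 0 := by
    rw [← hψ, hξdef, ratTwistedSymbolSum_ringHomComp, ratTwistedSymbolSum_ringHomComp, map_eq_zero, map_eq_zero]
  rw [hS, cyclotomic_comp_dvd_iff_ratTwistedSymbolSum_eq_zero hord hf hc hg n ξ hξ hξe hξo]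

/-- **All characters of `Γ` of the same conductor vanish together**: for `χ₁, χ₂ : (ℤ/p^m)^× → ℂ^×` primitive, even, of
`p`-power order, `m = n + 1 + e₀`, and entire continuations `L₁`, `L₂` of `L(f, χ₁, s)`, `L(f, χ₂, s)`:
`L₁(1) = 0 ⟺ L₂(1) = 0` (both are `Φ_{p^{n+1}}(1+T) ∣ g`; classically: Galois-equivariance of `L(f,χ,1)/τ(χ̄)Ω⁺`, Shimura).
[cite: MazurTateTeitelbaum1986Invent, §I.8, §I.14] -/
theorem twistedLValue_eq_zero_iff_of_conductor_eq (hord : IsOrdinaryAt W p) (hf : IsNewformOf W f) (n : ℕ)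
    (χ₁ χ₂ : DirichletCharacter ℂ (p ^ (n + 1 + cyclotomicExponent p)))
    (h₁ : χ₁.IsPrimitive) (h₁e : χ₁.Even) (h₁o : ∃ j : ℕ, orderOf χ₁ = p ^ j)
    (h₂ : χ₂.IsPrimitive) (h₂e : χ₂.Even) (h₂o : ∃ j : ℕ, orderOf χ₂ = p ^ j)
    {L₁ : ℂ → ℂ} (hL₁d : Differentiable ℂ L₁) (hL₁ : ∀ s : ℂ, 2 < s.re → L₁ s = twistedLSeries f χ₁ s)
    {L₂ : ℂ → ℂ} (hL₂d : Differentiable ℂ L₂) (hL₂ : ∀ s : ℂ, 2 < s.re → L₂ s = twistedLSeries f χ₂ s) :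
    L₁ 1 = 0 ↔ L₂ 1 = 0 := by
  obtain ⟨k, g, hg⟩ := memIwasawaRat_padicLFunction_holds (W := W) (p := p) (f := f) hord hf
  have hc : ((p : ℚ_[p]) ^ k) ≠ 0 := pow_ne_zero _ (Nat.cast_ne_zero.mpr hp.out.ne_zero)
  rw [twistedLValue_eq_zero_iff_cyclotomic_comp_dvd hord hf hc hg.symm n χ₁ h₁ h₁e h₁o hL₁d hL₁,
    twistedLValue_eq_zero_iff_cyclotomic_comp_dvd hord hf hc hg.symm n χ₂ h₂ h₂e h₂o hL₂d hL₂]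

/-- **Lift-free form**: `L(E, χ, 1) = 0` (for `χ` a character of `Γ` of conductor `p^{n+1+e₀}`) iff `Φ_{p^{n+1}}(1+T)` divides
EVERY integral lift of `L_p(E,T)` (iff some; integral lifts exist). [cite: MazurTateTeitelbaum1986Invent, §I.12–I.14] -/
theorem twistedLValue_eq_zero_iff_forall_lift (hord : IsOrdinaryAt W p) (hf : IsNewformOf W f) (n : ℕ)
    (χ : DirichletCharacter ℂ (p ^ (n + 1 + cyclotomicExponent p))) (hχ : χ.IsPrimitive) (hχe : χ.Even)
    (hχo : ∃ j : ℕ, orderOf χ = p ^ j) {L : ℂ → ℂ} (hLd : Differentiable ℂ L)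
    (hL : ∀ s : ℂ, 2 < s.re → L s = twistedLSeries f χ s) :
    L 1 = 0 ↔ ∀ (g : IwasawaAlgebra p) (c : ℚ_[p]), c ≠ 0 →
      iwasawaToPowerSeries p g = PowerSeries.C c * padicLFunction f (unitRoot W p : ℚ_[p]) →
        ((((cyclotomic (p ^ (n + 1)) ℤ).comp (X + 1)).map (Int.castRingHom ℤ_[p]) : ℤ_[p][X]) : IwasawaAlgebra p) ∣ g := by
  obtain ⟨k, g₀, hg₀⟩ := memIwasawaRat_padicLFunction_holds (W := W) (p := p) (f := f) hord hf
  have hc₀ : ((p : ℚ_[p]) ^ k) ≠ 0 := pow_ne_zero _ (Nat.cast_ne_zero.mpr hp.out.ne_zero)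
  refine ⟨fun h0 g c hc hg ↦ (twistedLValue_eq_zero_iff_cyclotomic_comp_dvd hord hf hc hg n χ hχ hχe hχo hLd hL).mp h0,
    fun h ↦ ?_⟩
  exact (twistedLValue_eq_zero_iff_cyclotomic_comp_dvd hord hf hc₀ hg₀.symm n χ hχ hχe hχo hLd hL).mpr (h g₀ _ hc₀ hg₀.symm)

end Summit.BirchSwinnertonDyer.BirchSwinnertonDyer.Theorems.LambdaTransportDoorTwistedLValueBridge

end
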